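import Summits.CriticalPhenomena.PercolationContinuityZ3.Theorems.Transplant.SkelPhiCorridorKGYValues
import HarnessLib

/-!
# N2 (frames-only node `SamePDropOfSkeletonFrm₁`, OPEN) — (ζ″) under (R-44)/(R-45): THE V HABITAT ROW FOR THE y′-CORRIDOR, pure-integer cores —
# `habY_gap_core` (G = 106 at `b₁ = 19·s₁`, `W_Y = 98·n_L`: a region box's east fine-0 numerator vs the arrival box's sum, symmetric parking growth),
# `habY_reading_core` (G = 106 ⇒ `rdHi₀ ≤ ⌊(LO+HI)/2⌋ + 54·s₀ + 1`, the room stated AFFINELY `hF 1 = c + 54·s₀ + 2`), and the generic `m2_mul_dec2_lt` (`m₂·dec₂ < T − (P+ρ−1)` from `kgM₂Y_spec`); the tuple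
# instance `habY_box_V` is SkelFrmBChoiceHabYW, the phase rows `hPRY_V` are SkelFrmBChoiceRegionsYV

NON-VACUITY: pure integer arithmetic (no tuple).
builds on p205010 (kernel theorem, internal audit signed; external expert review pending) — nothing in this file uses p205010; NOTHING is claimed about the
open node `SamePDropOfSkeletonFrm₁`.
Lane `prim-bschramm`, seat `prim-bschramm-stmt` (gen 21); helper file (`--supports stmt-CriticalPhenomena-4575 --as helper`).
[cite: KozmaNitzan2024, §4 Lemma 11 (p. 22), Lemma 12 (pp. 23–25)] [cite: MartineauTassion2017, §4.3 Lemma 4.2]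
-/

noncomputable section

namespace Summit.CriticalPhenomena.PercolationContinuityZ3.Theorems.Transplant

namespace PlanarSkeletonFrm

namespace NegB

open Skelφ

/-- **The pure-integer HABITAT GAP core** (G = 106 at `AQ = 19`, `W_Y = 98·n`, symmetric parking growth): for a region box of the y′-corridor — east corner
`hiB ≤ κ·v − v + X0 + j·(R′ + |v|)`, rows `κ·σ − Y0 + j·(σ − R′) ≤ loB1 ≤ hiB1 ≤ κ·(σ+2) + Y1`, `0 ≤ κ ≤ N+1`, `j ≤ 35`, `X0 ≤ 100n + (N+1)R′ + 200R′`,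
`U·Y0 ≤ 24Δ`, `U·Y1 ≤ 25Δ`, `50·U·XY ≤ 1081Δ + 2700U`, `XY ≥ 20σ`, `a₁ ≥ 194`, `j ≤ 41` — twice its east fine-0 numerator exceeds the arrival box's sum of numerators by at
most `106·nΔ` (drift `κ·v` against the arrival's `(N+1)·v` up to `(N+1)·2U ≤ 0.53Δ·2`; the arrival's own shear `−2v·U·XY` kept with its sign; for `v_L < 0` the
symmetric growth `j·|v_L|` of the parking set costs `70·nΔ`). [this work] -/
theorem habY_gap_core
    {n U Δ s K R v N a₁ XY P₀ C lo₀ hi₀ lo₁ G T₁ T₂ Am Ap κ j X0 Y0 Y1 hiB loB1 hiB1 ZB : ℤ}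
    (hn : 1 ≤ n) (hUn : n ≤ U) (hUs : U * s ≤ Δ) (hΔU : Δ ≤ U * s + 2 * U) (hs : 958 ≤ s) (hK : 80 ≤ K) (hR : 1 ≤ R)
    (hKR : 40 * K * R ≤ s + 1) (hnR : 40 * K * R + 1 ≤ n) (hv : |v| ≤ n)
    (hN0 : 0 ≤ N) (hN : N ≤ 21 * K + 2) (ha1 : 194 ≤ a₁) (hXY0 : 20 * s ≤ XY) (hXY : 50 * (U * XY) ≤ 1081 * Δ + 2700 * U) (hP0 : s ≤ P₀) (hP1 : P₀ ≤ s + 1)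
    (hC : C = 2 * (N + 1) * v - 2 * v + a₁ * n) (hsum0 : lo₀ + hi₀ = C)
    (hlo1 : lo₁ = (N + 1) * s + XY - P₀) (hG : G = U * P₀ + U - 1)
    (hT₁ : T₁ = v * (U * lo₁)) (hT₂ : T₂ = T₁ + v * G) (hAm : Am = Δ * lo₀ - max T₁ T₂) (hAp : Ap = Δ * hi₀ - min T₁ T₂)
    (hκ0 : 0 ≤ κ) (hκ : κ ≤ N + 1) (hj0 : 0 ≤ j) (hj : j ≤ 41)
    (hhiB : hiB ≤ κ * v - v + X0 + j * (R + |v|)) (hloB1 : κ * s - Y0 + j * (s - R) ≤ loB1) (hhiB1 : hiB1 ≤ κ * (s + 2) + Y1) (hlh : loB1 ≤ hiB1)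
    (hX0 : X0 ≤ 100 * n + (N + 1) * R + 200 * R) (hY00 : 0 ≤ Y0) (hY0 : U * Y0 ≤ 24 * Δ) (hY10 : 0 ≤ Y1) (hY1 : U * Y1 ≤ 25 * Δ)
    (hZB : ZB = Δ * hiB - min (v * (U * loB1)) (v * (U * hiB1 + U - 1))) :
    2 * ZB - (Am + Ap) ≤ 106 * (n * Δ) := by
  -- positivity
  have hU0 : 0 < U := by linarith
  have hn0 : 0 < n := by linarith
  have hR0 : 0 ≤ R := by linarith
  have hUs958 : 958 * U ≤ U * s := by have := mul_le_mul_of_nonneg_left hs hU0.le; linarith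
  have hUΔ : 958 * U ≤ Δ := hUs958.trans hUs
  have hΔ0 : 0 < Δ := by linarith
  have hnΔ : 0 < n * Δ := by positivity
  have hva := abs_nonneg v
  -- e := Δ − U s ∈ [0, 2U]
  have he0 : 0 ≤ Δ - U * s := by linarith
  have he1 : Δ - U * s ≤ 2 * U := by linarith
  -- K, R, N arithmetic (linear in the atoms K*R, R, N*R, …)
  have hKR80 : 80 * R ≤ K * R := mul_le_mul_of_nonneg_right hK hR0
  have hKRs : 21 * (K * R) + 3 * R ≤ s := by
    have e : 40 * K * R = 40 * (K * R) := by ring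
    linarith
  have h21K : 21 * K + 3 ≤ s := by
    have : K ≤ K * R := le_mul_of_one_le_right (by linarith) hR
    linarith
  have hNR : (N + 1) * R ≤ s := by
    have h1 := mul_le_mul_of_nonneg_right (show N + 1 ≤ 21 * K + 3 by linarith) hR0
    have e : (21 * K + 3) * R = 21 * (K * R) + 3 * R := by ring
    linarith
  have hNRn : (N + 1) * R ≤ n := by
    have h1 := mul_le_mul_of_nonneg_right (show N + 1 ≤ 21 * K + 3 by linarith) hR0
    have e1 : (21 * K + 3) * R = 21 * (K * R) + 3 * R := by ring
    have e : 40 * K * R = 40 * (K * R) := by ring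
    linarith
  have hNU : (N + 1) * U ≤ Δ := by
    have h1 : (N + 1) * U ≤ (21 * K + 3) * U := mul_le_mul_of_nonneg_right (by linarith) hU0.le
    have h2 : (21 * K + 3) * U ≤ s * U := mul_le_mul_of_nonneg_right h21K hU0.le
    linarith
  have hNU2 : 40 * ((N + 1) * U) ≤ 21 * Δ + 141 * U := by
    have h40K : 40 * K ≤ s + 1 := by
      have := le_mul_of_one_le_right (show (0 : ℤ) ≤ 40 * K by linarith) hR
      linarith
    have h1 : 40 * (N + 1) ≤ 21 * s + 141 := by linarith
    have := mul_le_mul_of_nonneg_right h1 hU0.le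
    linarith
  have h35R : 41 * R ≤ n := by
    have e : 40 * K * R = 40 * (K * R) := by ring
    linarith
  have hΔR : 41 * (Δ * R) ≤ n * Δ := by
    have := mul_le_mul_of_nonneg_left h35R hΔ0.le; linarith
  have hUR : U * R ≤ Δ := by
    have : U * R ≤ U * s := mul_le_mul_of_nonneg_left (by linarith) hU0.le
    linarith
  have h3200 : 3200 * R ≤ 40 * K * R := by
    have := mul_le_mul_of_nonneg_right (show (3200 : ℤ) ≤ 40 * K by linarith) hR0; linarith
  have hΔR' : 3200 * (Δ * R) ≤ n * Δ := by
    have := mul_le_mul_of_nonneg_left (show 3200 * R ≤ n by linarith) hΔ0.le; linarith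
  have hUR' : 3200 * (U * R) ≤ Δ + U := by
    have := mul_le_mul_of_nonneg_left (show 3200 * R ≤ s + 1 by linarith) hU0.le; linarith
  have hnUR' : 3200 * (n * (U * R)) ≤ n * Δ + n * U := by
    have := mul_le_mul_of_nonneg_left hUR' hn0.le; linarith
  -- the arrival sum `Am + Ap = Δ·C − (T₁ + T₂)`
  have hMs : max T₁ T₂ + min T₁ T₂ = T₁ + T₂ := max_add_min T₁ T₂
  have hSum : Am + Ap = Δ * C - (2 * (v * (U * lo₁)) + v * G) := by
    rw [hAm, hAp]
    have e : Δ * lo₀ - max T₁ T₂ + (Δ * hi₀ - min T₁ T₂) = Δ * (lo₀ + hi₀) - (max T₁ T₂ + min T₁ T₂) := by ring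
    rw [e, hMs, hsum0, hT₂, hT₁]; ring
  have hUl : U * loB1 ≤ U * hiB1 := mul_le_mul_of_nonneg_left hlh hU0.le
  have hX0' : 40 * X0 ≤ 4024 * n := by
    have h1 := mul_le_mul_of_nonneg_right (show N + 1 ≤ 21 * K + 3 by linarith) hR0
    have e1 : (21 * K + 3) * R = 21 * (K * R) + 3 * R := by ring
    have e : 40 * K * R = 40 * (K * R) := by ring
    have hKR80 : 80 * R ≤ K * R := mul_le_mul_of_nonneg_right hK hR0
    linarith
  have m1 : 40 * (Δ * X0) ≤ 4024 * (n * Δ) := by have := mul_le_mul_of_nonneg_left hX0' hΔ0.le; linarith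
  have ha1n : 194 * (n * Δ) ≤ a₁ * (n * Δ) := mul_le_mul_of_nonneg_right ha1 hnΔ.le
  have hU958 : 958 * U ≤ Δ := by have := mul_le_mul_of_nonneg_left hs hU0.le; linarith
  rcases le_total 0 v with hv0 | hv0
  · -- v ≥ 0
    have hva' : |v| = v := abs_of_nonneg hv0
    have hvn : v ≤ n := by rw [hva'] at hv; exact hv
    have hmin : v * (U * loB1) ≤ min (v * (U * loB1)) (v * (U * hiB1 + U - 1)) := by
      refine le_min le_rfl ?_
      exact mul_le_mul_of_nonneg_left (by linarith) hv0
    -- ZB ≤ Δ·hiB − v·U·loB1 ≤ …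
    have h1 : Δ * hiB ≤ Δ * (κ * v - v + X0 + j * (R + v)) := by
      have : hiB ≤ κ * v - v + X0 + j * (R + v) := by rw [hva'] at hhiB; exact hhiB
      exact mul_le_mul_of_nonneg_left this hΔ0.le
    have h2 : v * (U * (κ * s - Y0 + j * (s - R))) ≤ v * (U * loB1) :=
      mul_le_mul_of_nonneg_left (mul_le_mul_of_nonneg_left hloB1 hU0.le) hv0
    have hZ' : ZB ≤ κ * (v * (Δ - U * s)) - v * Δ + Δ * X0 + v * (U * Y0) + j * (Δ * R + v * (Δ - U * s) + v * (U * R)) := by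
      have e1 : Δ * (κ * v - v + X0 + j * (R + v)) - v * (U * (κ * s - Y0 + j * (s - R)))
          = κ * (v * (Δ - U * s)) - v * Δ + Δ * X0 + v * (U * Y0) + j * (Δ * R + v * (Δ - U * s) + v * (U * R)) := by ring
      rw [hZB]; linarith
    -- the drift cancels up to sign: κ·v·e ≤ (N+1)·v·e
    have hve0 : 0 ≤ v * (Δ - U * s) := mul_nonneg hv0 he0
    have hdrift : κ * (v * (Δ - U * s)) ≤ (N + 1) * (v * (Δ - U * s)) := mul_le_mul_of_nonneg_right hκ hve0
    -- monomials
    have m2 : v * Δ ≤ n * Δ := mul_le_mul_of_nonneg_right hvn hΔ0.le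
    have m2' : 0 ≤ v * Δ := mul_nonneg hv0 hΔ0.le
    have hXYnn : (0 : ℤ) ≤ XY := by linarith
    have m3 : v * (U * Y0) ≤ n * (24 * Δ) := mul_le_mul hvn hY0 (mul_nonneg hU0.le hY00) hn0.le
    have m4 : 50 * (v * (U * XY)) ≤ 50 * (n * (U * XY)) := by
      have := mul_le_mul_of_nonneg_right hvn (mul_nonneg hU0.le hXYnn); linarith
    have m4' : 50 * (n * (U * XY)) ≤ 1081 * (n * Δ) + 2700 * (n * U) := by
      have := mul_le_mul_of_nonneg_left hXY hn0.le; linarith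
    have hnU : n * U ≤ U * U := mul_le_mul_of_nonneg_right hUn hU0.le
    have hnU' : 958 * (n * U) ≤ n * Δ := by have := mul_le_mul_of_nonneg_left hU958 hn0.le; linarith
    have m5 : v * U ≤ v * (U * P₀) := by
      have : U ≤ U * P₀ := le_mul_of_one_le_right hU0.le (by linarith)
      exact mul_le_mul_of_nonneg_left this hv0
    -- the j term: Δ R + v e + v U R ≤ Δ R + 2 n U + n·(U R) and j ≤ 35
    have hve1 : v * (Δ - U * s) ≤ n * (2 * U) := mul_le_mul hvn he1 he0 hn0.le
    have hvUR : v * (U * R) ≤ n * (U * R) := mul_le_mul_of_nonneg_right hvn (by positivity)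
    have hjt : j * (Δ * R + v * (Δ - U * s) + v * (U * R)) ≤ 41 * (Δ * R + n * (2 * U) + n * (U * R)) := by
      have a0 : 0 ≤ Δ * R + v * (Δ - U * s) + v * (U * R) := by
        have : 0 ≤ v * (U * R) := mul_nonneg hv0 (by positivity)
        have : 0 ≤ Δ * R := by positivity
        linarith
      calc j * (Δ * R + v * (Δ - U * s) + v * (U * R)) ≤ j * (Δ * R + n * (2 * U) + n * (U * R)) :=
            mul_le_mul_of_nonneg_left (by linarith) hj0
        _ ≤ 41 * (Δ * R + n * (2 * U) + n * (U * R)) := mul_le_mul_of_nonneg_right hj (by positivity)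
    have hnU2 : 41 * (n * (2 * U)) ≤ n * Δ := by
      have : 82 * U ≤ Δ := by linarith
      have := mul_le_mul_of_nonneg_left this hn0.le; linarith
    have hnUR : 41 * (n * (U * R)) ≤ n * Δ := by
      have : 41 * (U * R) ≤ Δ := by
        have h' : U * (41 * R) ≤ U * s := mul_le_mul_of_nonneg_left (by linarith) hU0.le
        linarith
      have := mul_le_mul_of_nonneg_left this hn0.le; linarith
    have e2 : Δ * C - (2 * (v * (U * lo₁)) + v * G) = 2 * ((N + 1) * (v * (Δ - U * s))) - 2 * (v * Δ) + a₁ * (n * Δ) - 2 * (v * (U * XY)) + v * (U * P₀) - v * U + v := by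
      rw [hC, hlo1, hG]; ring
    rw [hSum, e2]
    linarith
  · -- v ≤ 0, w := −v
    have hva' : |v| = -v := abs_of_nonpos hv0
    set w := -v with hw
    have hw0 : 0 ≤ w := by linarith
    have hwn : w ≤ n := by rw [hva'] at hv; linarith
    have hmin : v * (U * hiB1 + U - 1) ≤ min (v * (U * loB1)) (v * (U * hiB1 + U - 1)) := by
      refine le_min ?_ le_rfl
      exact mul_le_mul_of_nonpos_left (by linarith) hv0
    have h1 : Δ * hiB ≤ Δ * (-(κ * w) + w + X0 + j * (R + w)) := by
      have : hiB ≤ -(κ * w) + w + X0 + j * (R + w) := by rw [hva'] at hhiB; rw [hw]; linarith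
      exact mul_le_mul_of_nonneg_left this hΔ0.le
    have h2 : w * (U * hiB1 + U - 1) ≤ w * (U * (κ * (s + 2) + Y1) + U - 1) := by
      have : U * hiB1 ≤ U * (κ * (s + 2) + Y1) := mul_le_mul_of_nonneg_left hhiB1 hU0.le
      exact mul_le_mul_of_nonneg_left (by linarith) hw0
    have hZ' : ZB ≤ κ * (w * (U * (s + 2) - Δ)) + w * Δ + Δ * X0 + j * (Δ * R) + j * (w * Δ) + w * (U * Y1) + w * U - w := by
      have e1 : Δ * (-(κ * w) + w + X0 + j * (R + w)) + w * (U * (κ * (s + 2) + Y1) + U - 1)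
          = κ * (w * (U * (s + 2) - Δ)) + w * Δ + Δ * X0 + j * (Δ * R) + j * (w * Δ) + w * (U * Y1) + w * U - w := by ring
      have h3 : -(v * (U * hiB1 + U - 1)) = w * (U * hiB1 + U - 1) := by rw [hw]; ring
      rw [hZB]; linarith
    -- monomials
    have m2 : w * Δ ≤ n * Δ := mul_le_mul_of_nonneg_right hwn hΔ0.le
    have m2' : 0 ≤ w * Δ := mul_nonneg hw0 hΔ0.le
    have m3 : w * (U * Y1) ≤ n * (25 * Δ) := mul_le_mul hwn hY1 (mul_nonneg hU0.le hY10) hn0.le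
    have m4 : w * (U * (20 * s)) ≤ w * (U * XY) := mul_le_mul_of_nonneg_left (mul_le_mul_of_nonneg_left hXY0 hU0.le) hw0
    have m4' : w * (U * (20 * s)) = 20 * (w * (U * s)) := by ring
    have m5 : w * (U * P₀) ≤ w * (U * (s + 1)) := mul_le_mul_of_nonneg_left (mul_le_mul_of_nonneg_left hP1 hU0.le) hw0
    have m5' : w * (U * (s + 1)) = w * (U * s) + w * U := by ring
    have m6 : κ * (w * (U * (s + 2) - Δ)) ≤ (N + 1) * (w * (2 * U)) := by
      have a1 : w * (U * (s + 2) - Δ) ≤ w * (2 * U) := mul_le_mul_of_nonneg_left (by linarith) hw0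
      have a2 : 0 ≤ w * (2 * U) := by positivity
      calc κ * (w * (U * (s + 2) - Δ)) ≤ κ * (w * (2 * U)) := mul_le_mul_of_nonneg_left a1 hκ0
        _ ≤ (N + 1) * (w * (2 * U)) := mul_le_mul_of_nonneg_right hκ a2
    have hNU2n : 40 * (n * ((N + 1) * U)) ≤ 21 * (n * Δ) + 141 * (n * U) := by
      have := mul_le_mul_of_nonneg_left hNU2 hn0.le; linarith
    have m7 : (N + 1) * (w * (2 * U)) ≤ 2 * (n * ((N + 1) * U)) := by
      have a1 : w * (2 * U) ≤ n * (2 * U) := mul_le_mul_of_nonneg_right hwn (by positivity)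
      have a2 : (N + 1) * (w * (2 * U)) ≤ (N + 1) * (n * (2 * U)) := mul_le_mul_of_nonneg_left a1 (by linarith)
      have a3 : (N + 1) * (n * (2 * U)) = 2 * (n * ((N + 1) * U)) := by ring
      linarith
    have m8 : (N + 1) * (w * (Δ - U * s)) ≤ 2 * (n * ((N + 1) * U)) := by
      have a1 : w * (Δ - U * s) ≤ n * (2 * U) := mul_le_mul hwn he1 he0 hn0.le
      have a2 : (N + 1) * (w * (Δ - U * s)) ≤ (N + 1) * (n * (2 * U)) := mul_le_mul_of_nonneg_left a1 (by linarith)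
      have a3 : (N + 1) * (n * (2 * U)) = 2 * (n * ((N + 1) * U)) := by ring
      linarith
    have m9 : j * (Δ * R) ≤ 41 * (Δ * R) := mul_le_mul_of_nonneg_right hj (by positivity)
    have m10 : j * (w * Δ) ≤ 41 * (w * Δ) := mul_le_mul_of_nonneg_right hj m2'
    have m11 : w * (U * s) ≤ w * Δ := mul_le_mul_of_nonneg_left hUs hw0
    have m11' : w * Δ ≤ w * (U * s) + w * (2 * U) := by
      have := mul_le_mul_of_nonneg_left hΔU hw0; linarith
    have m12 : w * U ≤ n * U := mul_le_mul_of_nonneg_right hwn hU0.le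
    have m12' : 0 ≤ w * U := by positivity
    have hnU : 958 * (n * U) ≤ n * Δ := by have := mul_le_mul_of_nonneg_left hUΔ hn0.le; linarith
    have e2 : Δ * C - (2 * (v * (U * lo₁)) + v * G) = -(2 * ((N + 1) * (w * (Δ - U * s)))) + 2 * (w * Δ) + a₁ * (n * Δ) + 2 * (w * (U * XY)) - w * (U * P₀) + w * U - w := by
      rw [hC, hlo1, hG, hw]; ring
    have hwe0 : 0 ≤ (N + 1) * (w * (Δ - U * s)) := mul_nonneg (by linarith) (mul_nonneg hw0 he0)
    rw [hSum, e2]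
    linarith

/-- **The pure-integer reading step** (G = 106, AFFINE room): the gap bound and the three floors give `rdHi₀(B) = FB + 1 ≤ ⌊(LO + HI)/2⌋ + 54·s₀ + 1` (`2·FB ≤ Fm + Fp + 108·s₀ + 1`). [this work] -/
theorem habY_reading_core {n Δ s₀ Am Ap ZB Fm Fp FB : ℤ}
    (hn : 1 ≤ n) (hΔ : 1 ≤ Δ) (hs0 : 1 ≤ s₀)
    (hgap : 2 * ZB - (Am + Ap) ≤ 106 * (n * Δ))
    (hF2 : s₀ * (Am - n) - n * Δ < n * Δ * Fm) (hF4 : s₀ * (Ap - n) - n * Δ < n * Δ * Fp) (hFB : n * Δ * FB ≤ s₀ * ZB) :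
    FB + 1 ≤ (Fm + (Fp + 1)) / 2 + 54 * s₀ + 1 := by
  have hn0 : 0 < n := by linarith
  have hnΔ : 0 < n * Δ := by positivity
  have hs0n : s₀ * n ≤ s₀ * (n * Δ) := by
    have : n ≤ n * Δ := le_mul_of_one_le_right hn0.le hΔ
    exact mul_le_mul_of_nonneg_left this (by linarith)
  have hnΔs : n * Δ ≤ s₀ * (n * Δ) := le_mul_of_one_le_left hnΔ.le hs0
  have hsg : s₀ * (2 * ZB - (Am + Ap)) ≤ s₀ * (106 * (n * Δ)) := mul_le_mul_of_nonneg_left hgap (by linarith)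
  have key : n * Δ * (2 * FB) < n * Δ * (Fm + Fp + 108 * s₀ + 2) := by
    have e1 : n * Δ * (2 * FB) = 2 * (n * Δ * FB) := by ring
    have e2 : n * Δ * (Fm + Fp + 108 * s₀ + 2) = n * Δ * Fm + n * Δ * Fp + 108 * (s₀ * (n * Δ)) + 2 * (n * Δ) := by ring
    have e3 : s₀ * (Am - n) = s₀ * Am - s₀ * n := by ring
    have e4 : s₀ * (Ap - n) = s₀ * Ap - s₀ * n := by ring
    have e5 : s₀ * (2 * ZB - (Am + Ap)) = 2 * (s₀ * ZB) - s₀ * Am - s₀ * Ap := by ring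
    have e6 : s₀ * (106 * (n * Δ)) = 106 * (s₀ * (n * Δ)) := by ring
    rw [e1, e2]; rw [e3] at hF2; rw [e4] at hF4; rw [e5, e6] at hsg
    linarith
  have h2 := lt_of_mul_lt_mul_left key hnΔ.le
  omega

/-- **`m₂·dec₂ < T − (P+ρ−1)`**: every along-parking step `j ≤ m₂Y` still sees the window `T − j·dec₂ ≥ P + ρ − 1` (from `kgM₂Y_spec`), so the step box's
`max (T − j·dec₂) (P+ρ−1)` is its first argument. [this work] -/
theorem m2_mul_dec2_lt {n ℓ : ℕ} {hs v : ℤ} {R' ρ q W : ℕ} (H : KGYRows n ℓ hs v R' ρ q W) (N : ℕ)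
    (hx : 0 < kgTY n ℓ hs v R' ρ q W N - ((n : ℤ) * ℓ / (shearUnit n hs : ℕ) + 1 + ρ - 1)) :
    ((kgM₂Y n ℓ hs v R' ρ q W N : ℕ) : ℤ) * kgDec₂Y n ℓ hs R' ρ < kgTY n ℓ hs v R' ρ q W N - ((n : ℤ) * ℓ / (shearUnit n hs : ℕ) + 1 + ρ - 1) := by
  have hspec := (H.kgM₂Y_spec N).1
  have hd : 0 < kgDec₂Y n ℓ hs R' ρ := by
    have h1 := H.dec₂_pos
    have h2 : (0 : ℤ) ≤ (ρ : ℤ) := by positivity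
    have h3 : (0 : ℤ) ≤ (R' : ℤ) := by positivity
    linarith
  set x := kgTY n ℓ hs v R' ρ q W N - ((n : ℤ) * ℓ / (shearUnit n hs : ℕ) + 1 + ρ - 1) with hxdef
  set d := kgDec₂Y n ℓ hs R' ρ with hddef
  have hfl : (x + d - 1) / d * d ≤ x + d - 1 := Int.ediv_mul_le _ (ne_of_gt hd)
  rcases le_total 1 ((x + d - 1) / d) with h1 | h1
  · rw [max_eq_right h1] at hspec
    have hm : ((kgM₂Y n ℓ hs v R' ρ q W N : ℕ) : ℤ) = (x + d - 1) / d - 1 := by linarith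
    have e : ((x + d - 1) / d - 1) * d = (x + d - 1) / d * d - d := by ring
    rw [hm, e]; linarith
  · rw [max_eq_left h1] at hspec
    have hm : ((kgM₂Y n ℓ hs v R' ρ q W N : ℕ) : ℤ) = 0 := by linarith
    rw [hm]; simpa using hx

end NegB

end PlanarSkeletonFrm

end Summit.CriticalPhenomena.PercolationContinuityZ3.Theorems.Transplant

end
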